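import Literature.MathematicalPhysics.KineticTheory.InfiniteChainDLRUniqueness

/-!
# `LatticeLandauDamping.AbelThermodynamicLimit`, line `series-law-at-every-laplace-frequency`:
DLR uniqueness in the regular class (stub `stub_regularDLRUnique`)

Support file for item `stmt-AtomisticToContinuum-14013` (shared verbatim with the sibling cruxes
`EmbeddedDrudeMourre.AbelThermodynamicLimit`, stmt-12596, loomis S7, and
`EmbeddedDrudeMourre.GreenKuboContinuation`, stmt-12597, Stub 2). For the pinned anharmonic chain
`P = pinnedChain ω₂ lam β γ` (all parameters `> 0`) and `T > 0`, any two DLR Gibbs states at `T` that are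
shift invariant and obey Buttà–Marchioro's superstability estimate (2.3) coincide.

Route (classical one-dimensional transfer-operator argument, Georgii 2011 Thm 10.25 / §11.1;
Cassandro–Olivieri–Pellegrinotti–Presutti 1978 §2 for unbounded spins), entirely in `Literature`:
`OscillatorChain.pinnedChain_eq_of_isChainGibbsMeasure_of_isShiftInvariant`
(`InfiniteChainDLRUniqueness.lean`) — the interval kernels `γ_Λ(A | η)` of a cylinder event are ratios
of interval Boltzmann integrals (`IntervalBoltzmannTransferForm.lean`), which become independent of the
boundary condition uniformly on compact sets of boundary spins by Jentzsch's spectral gap and power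
iteration for the strictly positive Hilbert–Schmidt transfer operator `e^{-V(q'-q)/T}` on
`L²(e^{-(p²/2+U)/T} dq dp)` (`TransferRatioBoundaryLimit.lean`, `IntervalGibbsRatioLimit.lean`,
`Literature.Analysis.OperatorTheory.KernelRatioLimit`); a shift-invariant state has uniformly tight
one-site marginals, so the abstract DLR step `DLRUniquenessCriterion.lean` gives equality on the
cylinder π-system. The superstability hypotheses of the stub are not needed (shift invariance alone
suffices) and are discarded.
-/

noncomputable section

open Literature.MathematicalPhysics.KineticTheory.HeatConduction

namespace Summit.AtomisticToContinuum.FouriersLaw.Theorems.AbelThermodynamicLimit.SeriesLawAtEveryLaplaceFrequency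

/-- **Stub `stub_regularDLRUnique` (registered signature, verbatim): DLR UNIQUENESS IN THE REGULAR CLASS.**
For `pinnedChain ω₂ lam β γ` (all `> 0`) and `T > 0`, two DLR Gibbs states at `T` which are shift
invariant and satisfy BM's superstability estimate (2.3) are equal. One-liner from the Literature theorem
`OscillatorChain.pinnedChain_eq_of_isChainGibbsMeasure_of_isShiftInvariant` (uniqueness among ALL
shift-invariant DLR states; `0 < lam`, `0 < β` enter through `≤`, `0 < γ` and (2.3) are decoration).
[cite: Georgii2011, Thm 10.25 and §11.1] -/
theorem stub_regularDLRUnique :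
    ∀ ω₂ lam β γ : ℝ, 0 < ω₂ → 0 < lam → 0 < β → 0 < γ →
      ∀ T : ℝ, 0 < T →
        ∀ μ₁ μ₂ : MeasureTheory.Measure
            Literature.MathematicalPhysics.KineticTheory.HeatConduction.ChainConfig,
          (Literature.MathematicalPhysics.KineticTheory.HeatConduction.pinnedChain
                ω₂ lam β γ).IsChainGibbsMeasure T μ₁ →
          Literature.MathematicalPhysics.KineticTheory.HeatConduction.IsShiftInvariant μ₁ →
          (Literature.MathematicalPhysics.KineticTheory.HeatConduction.pinnedChain
                ω₂ lam β γ).HasSuperstabilityEstimate μ₁ →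
          (Literature.MathematicalPhysics.KineticTheory.HeatConduction.pinnedChain
                ω₂ lam β γ).IsChainGibbsMeasure T μ₂ →
          Literature.MathematicalPhysics.KineticTheory.HeatConduction.IsShiftInvariant μ₂ →
          (Literature.MathematicalPhysics.KineticTheory.HeatConduction.pinnedChain
                ω₂ lam β γ).HasSuperstabilityEstimate μ₂ → μ₁ = μ₂ :=
  fun _ω₂ _lam _β γ hω hl hβ _hγ _T hT _μ₁ _μ₂ h₁ hs₁ _ h₂ hs₂ _ =>
    OscillatorChain.pinnedChain_eq_of_isChainGibbsMeasure_of_isShiftInvariant γ hω hl.le hβ.le hT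
      h₁ hs₁ h₂ hs₂

end Summit.AtomisticToContinuum.FouriersLaw.Theorems.AbelThermodynamicLimit.SeriesLawAtEveryLaplaceFrequency

end
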